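import Summits.HubbardSuperconductivity.HubbardSuperconductivity.Theorems.AnisotropyChordTransferFibre3NDeriv

/-!
# Route `AnisotropyChord` / H0 rotor rung: PORT N30-A revised targets — `PhiAntitone` PROVED (`L ≥ 4`)

LEMMA ANTITONE of memo ROTOR-THEORY-20 §279(b),(d) (theory seat `hubbard-h0-rotor-theory-1`, cycle 20): on any interval
`[T₁, T₂]`, `T₂ < 2ε₁`, on which the Krein matrix `𝒩(T)` stays invertible, the Krein functional `Φ(T) = ⟨v, 𝒩(T)⁻¹v⟩/(3V²)`
is non-increasing — **`phiAntitone_holds (hL : 4 ≤ L) (Δ : ℝ) : PhiAntitone L Δ`**.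
Proof (resolvent identity): the entries of `𝒩(T)⁻¹ = det⁻¹·adj` are differentiable where `det 𝒩 ≠ 0`
(`differentiableAt_inv_apply`); differentiating `𝒩𝒩⁻¹ = 1` on a neighbourhood gives `(𝒩⁻¹)' = −𝒩⁻¹ 𝒩' 𝒩⁻¹`
(`Dmat_eq`); with `𝒩` Hermitian and `𝒩' = G_T² ≥ 0` (`…Fibre3NDeriv`) this yields `3V²Φ' = −⟨x, G_T² x⟩ ≤ 0`,
`x = 𝒩⁻¹v`, and `antitoneOn_of_deriv_nonpos` concludes.  With `…Fibre3Certificate` the only analytic input of the ∀L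
GM₃ certificate still open is `NInvertibleBelow` (lemma L2).
Prover seat `hubbard-h0-rotor-p1` g21; helper for stmt-HubbardSuperconductivity-19089 (`--supports`).
-/

set_option linter.dupNamespace false
set_option autoImplicit false

noncomputable section

open scoped BigOperators
open Complex Matrix

namespace Summit.HubbardSuperconductivity.HubbardSuperconductivity.Theorems.AnisotropyChord.Transfer.Fibre3

section MatrixCalculus

variable {ι : Type} [Fintype ι] [DecidableEq ι]

/-- the determinant of an entrywise-differentiable matrix function is differentiable. [folklore] -/
theorem differentiableAt_det (M : ℝ → Matrix ι ι ℂ) (T : ℝ) (h : ∀ a b, DifferentiableAt ℝ (fun t => M t a b) T) :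
    DifferentiableAt ℝ (fun t => (M t).det) T := by
  have e : (fun t => (M t).det) = fun t => ∑ σ : Equiv.Perm ι, (Equiv.Perm.sign σ : ℂ) * ∏ i, M t (σ i) i := by
    funext t; rw [Matrix.det_apply']
  rw [e]
  apply DifferentiableAt.fun_sum
  intro σ _
  apply DifferentiableAt.const_mul
  apply DifferentiableAt.fun_finsetProd
  intro i _
  exact h _ _

/-- the entries of the inverse of an entrywise-differentiable matrix function are differentiable where the
determinant does not vanish (`M⁻¹ = det⁻¹ · adj`). [folklore] -/
theorem differentiableAt_inv_apply (M : ℝ → Matrix ι ι ℂ) (T : ℝ) (h : ∀ a b, DifferentiableAt ℝ (fun t => M t a b) T)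
    (hdet : (M T).det ≠ 0) (i j : ι) : DifferentiableAt ℝ (fun t => (M t)⁻¹ i j) T := by
  have e : (fun t => (M t)⁻¹ i j) = fun t => ((M t).det)⁻¹ * ((M t).updateRow j (Pi.single i 1)).det := by
    funext t
    rw [Matrix.inv_def, Matrix.smul_apply, Ring.inverse_eq_inv, Matrix.adjugate_apply, smul_eq_mul]
  rw [e]
  have hd := differentiableAt_det M T h
  have hinv : DifferentiableAt ℝ (fun t => ((M t).det)⁻¹) T :=
    ((hasDerivAt_inv hdet).comp T hd.hasDerivAt).differentiableAt
  refine hinv.mul (differentiableAt_det (fun t => (M t).updateRow j (Pi.single i 1)) T ?_)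
  intro a b
  by_cases ha : a = j
  · subst ha
    simp only [Matrix.updateRow_self]; exact differentiableAt_const _
  · simp only [Matrix.updateRow_ne ha]; exact h a b

end MatrixCalculus

variable (L : ℕ) [NeZero L]

/-- [folklore] -/
theorem differentiableAt_Nmat (hL : 4 ≤ L) {T : ℝ} (hT : T < 2 * eps1 L) (Δ : ℝ) (i j : DS L) :
    DifferentiableAt ℝ (fun t => Nmat L t Δ i j) T :=
  (hasDerivAt_Nmat L hL hT Δ i j).differentiableAt

/-- the entrywise `T`-derivative of `𝒩(T)⁻¹`. [folklore] -/
def Dmat (Δ T : ℝ) : Matrix (DS L) (DS L) ℂ := fun i j => deriv (fun t => (Nmat L t Δ)⁻¹ i j) T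

/-- the entries of `𝒩(T)⁻¹` are differentiable where `det 𝒩(T) ≠ 0` (`T < 2ε₁`, `L ≥ 4`). [folklore] -/
theorem hasDerivAt_Ninv (hL : 4 ≤ L) {T : ℝ} (hT : T < 2 * eps1 L) (Δ : ℝ) (hdet : (Nmat L T Δ).det ≠ 0)
    (i j : DS L) : HasDerivAt (fun t => (Nmat L t Δ)⁻¹ i j) (Dmat L Δ T i j) T :=
  (differentiableAt_inv_apply (fun t => Nmat L t Δ) T (fun a b => differentiableAt_Nmat L hL hT Δ a b) hdet i j).hasDerivAt

/-- **resolvent identity, differentiated:** `𝒩·(𝒩⁻¹)' + 𝒩'·𝒩⁻¹ = 0`. [folklore] -/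
theorem Nmat_mul_Dmat (hL : 4 ≤ L) {T : ℝ} (hT : T < 2 * eps1 L) (Δ : ℝ) (hdet : (Nmat L T Δ).det ≠ 0) :
    Nmat L T Δ * Dmat L Δ T + G2mat L T * (Nmat L T Δ)⁻¹ = 0 := by
  ext i j
  have hf : HasDerivAt (fun t => ∑ k : DS L, Nmat L t Δ i k * (Nmat L t Δ)⁻¹ k j)
      (∑ k : DS L, (G2entry L T (cfgOf L i) (cfgOf L k) * (Nmat L T Δ)⁻¹ k j
        + Nmat L T Δ i k * Dmat L Δ T k j)) T := by
    apply HasDerivAt.fun_sum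
    intro k _
    exact (hasDerivAt_Nmat L hL hT Δ i k).mul (hasDerivAt_Ninv L hL hT Δ hdet k j)
  have hcont : ContinuousAt (fun t => (Nmat L t Δ).det) T :=
    (differentiableAt_det (fun t => Nmat L t Δ) T (fun a b => differentiableAt_Nmat L hL hT Δ a b)).continuousAt
  have hev : (fun _ : ℝ => (1 : Matrix (DS L) (DS L) ℂ) i j)
      =ᶠ[nhds T] (fun t => ∑ k : DS L, Nmat L t Δ i k * (Nmat L t Δ)⁻¹ k j) := by
    filter_upwards [hcont.eventually_ne hdet] with t ht
    rw [← Matrix.mul_apply, Matrix.mul_nonsing_inv _ (isUnit_iff_ne_zero.mpr ht)]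
  have h0 : HasDerivAt (fun t => ∑ k : DS L, Nmat L t Δ i k * (Nmat L t Δ)⁻¹ k j) 0 T :=
    (hasDerivAt_const T ((1 : Matrix (DS L) (DS L) ℂ) i j)).congr_of_eventuallyEq hev.symm
  have hu := hf.unique h0
  rw [Matrix.add_apply, Matrix.mul_apply, Matrix.mul_apply, ← Finset.sum_add_distrib, Matrix.zero_apply, ← hu]
  refine Finset.sum_congr rfl fun k _ => ?_
  unfold G2mat
  ring

/-- **`(𝒩⁻¹)' = −𝒩⁻¹ G_T² 𝒩⁻¹`.** [folklore] -/
theorem Dmat_eq (hL : 4 ≤ L) {T : ℝ} (hT : T < 2 * eps1 L) (Δ : ℝ) (hdet : (Nmat L T Δ).det ≠ 0) :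
    Dmat L Δ T = -((Nmat L T Δ)⁻¹ * G2mat L T * (Nmat L T Δ)⁻¹) := by
  have h := Nmat_mul_Dmat L hL hT Δ hdet
  have hXN : (Nmat L T Δ)⁻¹ * Nmat L T Δ = 1 := Matrix.nonsing_inv_mul _ (isUnit_iff_ne_zero.mpr hdet)
  calc Dmat L Δ T = 1 * Dmat L Δ T := (Matrix.one_mul _).symm
    _ = (Nmat L T Δ)⁻¹ * (Nmat L T Δ * Dmat L Δ T) := by rw [← hXN, Matrix.mul_assoc]
    _ = (Nmat L T Δ)⁻¹ * (-(G2mat L T * (Nmat L T Δ)⁻¹)) := by rw [eq_neg_of_add_eq_zero_left h]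
    _ = -((Nmat L T Δ)⁻¹ * G2mat L T * (Nmat L T Δ)⁻¹) := by rw [Matrix.mul_neg, Matrix.mul_assoc]

/-- **`Φ` is differentiable** where `𝒩` is invertible, with `3V²Φ'(T) = Re⟨v, (𝒩⁻¹)'(T) v⟩`. [folklore] -/
theorem hasDerivAt_Phi (hL : 4 ≤ L) {T : ℝ} (hT : T < 2 * eps1 L) (Δ : ℝ) (hdet : (Nmat L T Δ).det ≠ 0) :
    HasDerivAt (fun t => Phi L t Δ)
      ((star (vpole L) ⬝ᵥ (Dmat L Δ T).mulVec (vpole L)).re / (3 * ((L : ℝ) ^ 2) ^ 2)) T := by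
  unfold Phi
  have hg : HasDerivAt (fun t => star (vpole L) ⬝ᵥ ((Nmat L t Δ)⁻¹).mulVec (vpole L))
      (star (vpole L) ⬝ᵥ (Dmat L Δ T).mulVec (vpole L)) T := by
    simp only [dotProduct, Matrix.mulVec, Pi.star_apply]
    apply HasDerivAt.fun_sum
    intro i _
    apply HasDerivAt.const_mul
    apply HasDerivAt.fun_sum
    intro j _
    exact (hasDerivAt_Ninv L hL hT Δ hdet i j).mul_const _
  have hre := Complex.reCLM.hasFDerivAt.comp_hasDerivAt T hg
  have hre' : HasDerivAt (fun t => (star (vpole L) ⬝ᵥ ((Nmat L t Δ)⁻¹).mulVec (vpole L)).re)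
      ((star (vpole L) ⬝ᵥ (Dmat L Δ T).mulVec (vpole L)).re) T := by
    convert hre using 1 <;> rfl
  exact hre'.div_const _

/-- **the sign:** `Re⟨v, (𝒩⁻¹)' v⟩ = −Re⟨x, G_T² x⟩ ≤ 0`, `x = 𝒩⁻¹v` (`𝒩` Hermitian, `G_T² ≥ 0`). [folklore] -/
theorem derivPhi_nonpos (hL : 4 ≤ L) {T : ℝ} (hT : T < 2 * eps1 L) (Δ : ℝ) (hdet : (Nmat L T Δ).det ≠ 0) :
    (star (vpole L) ⬝ᵥ (Dmat L Δ T).mulVec (vpole L)).re / (3 * ((L : ℝ) ^ 2) ^ 2) ≤ 0 := by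
  rw [Dmat_eq L hL hT Δ hdet]
  have hX : ((Nmat L T Δ)⁻¹)ᴴ = (Nmat L T Δ)⁻¹ := by
    rw [Matrix.conjTranspose_nonsing_inv, Nmat_conjTranspose]
  have hq : star (vpole L) ⬝ᵥ ((Nmat L T Δ)⁻¹ * G2mat L T * (Nmat L T Δ)⁻¹).mulVec (vpole L)
      = star (((Nmat L T Δ)⁻¹).mulVec (vpole L)) ⬝ᵥ (G2mat L T).mulVec (((Nmat L T Δ)⁻¹).mulVec (vpole L)) := by
    rw [← Matrix.mulVec_mulVec, ← Matrix.mulVec_mulVec, Matrix.dotProduct_mulVec, Matrix.star_mulVec, hX]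
  rw [Matrix.neg_mulVec, dotProduct_neg, Complex.neg_re, hq, neg_div]
  exact neg_nonpos.mpr (div_nonneg (re_G2form_nonneg L T _) (by positivity))

/-- **`PhiAntitone` holds** (`L ≥ 4`, every `Δ`). [folklore] -/
theorem phiAntitone_holds (hL : 4 ≤ L) (Δ : ℝ) : PhiAntitone L Δ := by
  intro T₁ T₂ h12 hT2 hdet
  have hd : ∀ t ∈ Set.Icc T₁ T₂, HasDerivAt (fun s => Phi L s Δ)
      ((star (vpole L) ⬝ᵥ (Dmat L Δ t).mulVec (vpole L)).re / (3 * ((L : ℝ) ^ 2) ^ 2)) t :=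
    fun t ht => hasDerivAt_Phi L hL (lt_of_le_of_lt ht.2 hT2) Δ (hdet t ht)
  have key : AntitoneOn (fun t => Phi L t Δ) (Set.Icc T₁ T₂) := by
    apply antitoneOn_of_deriv_nonpos (convex_Icc T₁ T₂)
    · intro t ht; exact (hd t ht).continuousAt.continuousWithinAt
    · intro t ht
      exact (hd t (interior_subset ht)).differentiableAt.differentiableWithinAt
    · intro t ht
      have ht' : t ∈ Set.Icc T₁ T₂ := interior_subset ht
      rw [(hd t ht').deriv]
      exact derivPhi_nonpos L hL (lt_of_le_of_lt ht'.2 hT2) Δ (hdet t ht')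
  exact key (Set.left_mem_Icc.mpr h12) (Set.right_mem_Icc.mpr h12) h12

end Summit.HubbardSuperconductivity.HubbardSuperconductivity.Theorems.AnisotropyChord.Transfer.Fibre3

end
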